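import Summits.NavierStokesRegularity.OSWSelfSimilar.SheetRCentreOfRecordValue
import Summits.NavierStokesRegularity.OSWSelfSimilar.SheetRCentreOfRecordSineData
import HarnessLib

/-!
# SHEET-ℝ frame: the typed centre of record (FRAME form) EQUALS cert-1's JSON centre (SINE form) — kernel-checked provenance

HONEST FRAMING (cell ns-blowup GROUP B / zone Z3, cases Z3-SR-CERT / Z3-SR-SPEC; 1-D MODEL certificate frame; not Euler/NS; «violates: none —
MODEL»).  `SheetRCentreOfRecord.centreOfRecord` is `Σ_{i<767} d_{i+1}·(1 + cos θ)sin((i+1)θ) + α₂·64·T₂` with the frame coefficients `d_n` of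
`SheetRCentreOfRecordData` (re-encoded OFFLINE from cert-1's sine coefficients); cert-1's object of record (`centre_L8_refit_rational.json`
c4de65e13d80c930) is `Σ_{k=1}^{768} b_k sin kθ + α₂·64·T₂` with the `b_k` of `SheetRCentreOfRecordSineData` (VERBATIM).  This file removes the word
«offline»: it proves IN THE KERNEL that the two functions are EQUAL at every `ξ` (**`centreOfRecord_eq_sineForm`**):

* `frame_succ_eq` — the product-to-sum identity `(1 + cos θ)sin((m+1)θ) = sin((m+1)θ) + ½[sin((m+2)θ) + sin(mθ)]`;
* `frameSum_eq_sineSum` — hence, for coefficients vanishing from index `N` on, `Σ_{i<N} d_i e_{i+1} = Σ_{k<N+1} (d_k + ½(d_{k−1} + d_{k+1})) sin((k+1)θ)`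
  (three reindexed sums);
* `sine_relation` — **`b_{k+1} = d_{k+1} + ½(d_k + d_{k+2})` for all `k < 768`**, checked on the two rational tables by `decide` in the kernel
  (`sine_relation_all`), together with the table lengths (`centreFrameTable_length = 767`, so `d` vanishes from index `767` on).
No named fact; two computable rational bookkeeping definitions (`sineQ`, `dprevQ`).  WHAT THIS IS NOT: not NS; no certificate sentence; the sine
coefficients are cert-1's float re-fit turned exact — nothing about their quality is asserted.
-/

noncomputable section

namespace Summit.NavierStokesRegularity.OSWSelfSimilar
namespace SheetRCentreOfRecordSine

open _root_.Real SheetRFrameCentre SheetRCentreOfRecord SheetRCentreOfRecordValue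

/-! ### §1 The frame in sine coordinates -/

/-- **Product-to-sum**: `(1 + cos θ)·sin((m+1)θ) = sin((m+1)θ) + ½(sin((m+2)θ) + sin(mθ))`. [folklore] -/
theorem frame_succ_eq (L : ℝ) (m : ℕ) (ξ : ℝ) :
    frame L (m + 1) ξ = Real.sin ((m + 1 : ℕ) * (2 * arctan (ξ / L)))
      + (Real.sin ((m + 2 : ℕ) * (2 * arctan (ξ / L))) + Real.sin (m * (2 * arctan (ξ / L)))) / 2 := by
  rw [frame]
  set θ := 2 * arctan (ξ / L) with hθ
  have h1 : ((m + 2 : ℕ) : ℝ) * θ = ((m + 1 : ℕ) : ℝ) * θ + θ := by push_cast; ring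
  have h2 : (m : ℝ) * θ = ((m + 1 : ℕ) : ℝ) * θ - θ := by push_cast; ring
  rw [h1, h2, Real.sin_add, Real.sin_sub]
  ring

/-- The previous coefficient `d_{k−1}` (with `d_{−1} = 0`). [folklore] -/
def dprev (d : ℕ → ℝ) (k : ℕ) : ℝ := if k = 0 then 0 else d (k - 1)

/-- **Frame sum = sine sum**: if `d_i = 0` for `i ≥ N` then
`Σ_{i<N} d_i e_{i+1}(ξ) = Σ_{k<N+1} (d_k + ½(d_{k−1} + d_{k+1}))·sin((k+1)θ)`. [folklore] -/
theorem frameSum_eq_sineSum (L : ℝ) (N : ℕ) (d : ℕ → ℝ) (hd : ∀ i, N ≤ i → d i = 0) (ξ : ℝ) :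
    (∑ i ∈ Finset.range N, d i * frame L (i + 1) ξ) =
      ∑ k ∈ Finset.range (N + 1), (d k + (dprev d k + d (k + 1)) / 2) * Real.sin ((k + 1 : ℕ) * (2 * arctan (ξ / L))) := by
  set θ := 2 * arctan (ξ / L) with hθ
  -- the three sine sums
  have hA : (∑ i ∈ Finset.range N, d i * Real.sin ((i + 1 : ℕ) * θ)) =
      ∑ k ∈ Finset.range (N + 1), d k * Real.sin ((k + 1 : ℕ) * θ) := by
    rw [Finset.sum_range_succ, hd N le_rfl, zero_mul, add_zero]
  have hB : (∑ i ∈ Finset.range N, d i * Real.sin ((i + 2 : ℕ) * θ)) =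
      ∑ k ∈ Finset.range (N + 1), dprev d k * Real.sin ((k + 1 : ℕ) * θ) := by
    rw [Finset.sum_range_succ']
    simp only [dprev, Nat.succ_ne_zero, ↓reduceIte, Nat.add_sub_cancel, zero_mul, add_zero]
  have hC : (∑ i ∈ Finset.range N, d i * Real.sin (i * θ)) =
      ∑ k ∈ Finset.range (N + 1), d (k + 1) * Real.sin ((k + 1 : ℕ) * θ) := by
    have h2 : (∑ i ∈ Finset.range (N + 2), d i * Real.sin (i * θ)) = ∑ i ∈ Finset.range N, d i * Real.sin (i * θ) := by
      rw [Finset.sum_range_succ, Finset.sum_range_succ, hd N le_rfl, hd (N + 1) (Nat.le_succ N)]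
      simp
    rw [← h2, Finset.sum_range_succ']
    simp
  calc (∑ i ∈ Finset.range N, d i * frame L (i + 1) ξ)
      = ∑ i ∈ Finset.range N, (d i * Real.sin ((i + 1 : ℕ) * θ)
          + (d i * Real.sin ((i + 2 : ℕ) * θ) + d i * Real.sin (i * θ)) / 2) := by
        refine Finset.sum_congr rfl fun i _ => ?_
        rw [frame_succ_eq]; ring
    _ = (∑ i ∈ Finset.range N, d i * Real.sin ((i + 1 : ℕ) * θ))
          + ((∑ i ∈ Finset.range N, d i * Real.sin ((i + 2 : ℕ) * θ)) + ∑ i ∈ Finset.range N, d i * Real.sin (i * θ)) / 2 := by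
        rw [Finset.sum_add_distrib]
        conv_rhs => rw [← Finset.sum_add_distrib, Finset.sum_div]
    _ = ∑ k ∈ Finset.range (N + 1), (d k + (dprev d k + d (k + 1)) / 2) * Real.sin ((k + 1 : ℕ) * θ) := by
        rw [hA, hB, hC, ← Finset.sum_add_distrib, Finset.sum_div, ← Finset.sum_add_distrib]
        refine Finset.sum_congr rfl fun k _ => ?_
        ring

/-! ### §2 The two rational tables satisfy `b_{k+1} = d_{k+1} + ½(d_k + d_{k+2})` — checked in the kernel -/

/-- The `i`-th sine coefficient as a rational: `b_{i+1} = p/2^e`. [folklore] -/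
def sineQ (i : ℕ) : ℚ := mkRat (centreSineTable.getD i (0, 0)).1 (2 ^ (centreSineTable.getD i (0, 0)).2)

/-- The previous frame coefficient as a rational (`0` at `k = 0`). [folklore] -/
def dprevQ (k : ℕ) : ℚ := if k = 0 then 0 else coeffQ (k - 1)

/-- The frame table has `767` entries (kernel count). [folklore] -/
theorem centreFrameTable_length : centreFrameTable.length = 767 := by
  decide +kernel

/-- **KERNEL CHECK of the re-encoding**: `b_{k+1} = d_{k+1} + ½(d_k + d_{k+2})` for every `k < 768` (all `768` rational identities, by `decide`
on the two data tables). [folklore] -/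
theorem sine_relation_all :
    ((List.range 768).all fun k => decide (sineQ k = coeffQ k + (dprevQ k + coeffQ (k + 1)) / 2)) = true := by
  decide +kernel

/-- `b_{k+1} = d_{k+1} + ½(d_k + d_{k+2})` for `k < 768`. [folklore] -/
theorem sine_relation {k : ℕ} (hk : k < 768) : sineQ k = coeffQ k + (dprevQ k + coeffQ (k + 1)) / 2 := by
  have h := List.all_eq_true.1 sine_relation_all k (List.mem_range.2 hk)
  exact of_decide_eq_true h

/-- The real sine coefficient is the cast of the rational one. [folklore] -/
theorem centreSineCoeff_eq_cast (i : ℕ) : centreSineCoeff i = ((sineQ i : ℚ) : ℝ) := by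
  rw [centreSineCoeff, sineQ, Rat.cast_mkRat_of_ne_zero _ (by positivity)]
  push_cast
  rfl

/-- `d` vanishes from index `767` on. [folklore] -/
theorem centreCoeff_eq_zero {i : ℕ} (hi : 767 ≤ i) : centreCoeff i = 0 := by
  rw [centreCoeff, List.getD_eq_default _ _ (by rw [centreFrameTable_length]; exact hi)]
  simp

/-- `coeffQ` vanishes from index `767` on. [folklore] -/
theorem coeffQ_eq_zero {i : ℕ} (hi : 767 ≤ i) : coeffQ i = 0 := by
  rw [coeffQ, List.getD_eq_default _ _ (by rw [centreFrameTable_length]; exact hi)]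
  simp

/-- The real previous-coefficient function is the cast of the rational one. [folklore] -/
theorem dprev_eq_cast (k : ℕ) : dprev centreCoeff k = ((dprevQ k : ℚ) : ℝ) := by
  unfold dprev dprevQ
  split_ifs <;> simp [centreCoeff_eq_cast]

/-! ### §3 The equality of the two forms -/

/-- **THE TYPED CENTRE EQUALS CERT-1'S SINE-FORM CENTRE**: for every `ξ`,
`centreOfRecord ξ = Σ_{k<768} b_{k+1}·sin((k+1)θ(ξ)) + α₂·8²·T₂(ξ)`, `θ(ξ) = 2arctan(ξ/8)`, with the `b_k` of cert-1's JSON verbatim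
(`SheetRCentreOfRecordSineData`).  Kernel-checked provenance of the typed centre. [folklore] -/
theorem centreOfRecord_eq_sineForm (ξ : ℝ) :
    centreOfRecord ξ = (∑ k ∈ Finset.range 768, centreSineCoeff k * Real.sin ((k + 1 : ℕ) * (2 * arctan (ξ / 8))))
      + centreAlpha2 * ((8 : ℝ) ^ 2 * farT2 8 ξ) := by
  have h : centreOfRecord ξ = (∑ i ∈ Finset.range 767, centreCoeff i * frame 8 (i + 1) ξ) + centreAlpha2 * ((8 : ℝ) ^ 2 * farT2 8 ξ) := rfl
  rw [h, frameSum_eq_sineSum 8 767 centreCoeff (fun i hi => centreCoeff_eq_zero hi) ξ]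
  refine congrArg₂ (· + ·) (Finset.sum_congr rfl fun k hk => ?_) rfl
  have hk' : k < 768 := Finset.mem_range.1 hk
  have hcoef : centreSineCoeff k = centreCoeff k + (dprev centreCoeff k + centreCoeff (k + 1)) / 2 := by
    rw [centreSineCoeff_eq_cast, sine_relation hk', dprev_eq_cast, centreCoeff_eq_cast, centreCoeff_eq_cast]
    push_cast
    ring
  rw [hcoef]

end SheetRCentreOfRecordSine
end Summit.NavierStokesRegularity.OSWSelfSimilar

end
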